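import Mathlib.Analysis.Normed.Field.Basic
import Mathlib.Analysis.Normed.Group.Ultra
import Mathlib.Algebra.Order.GroupWithZero.Basic
import Mathlib.Tactic.Linarith
import Mathlib.Tactic.Positivity
import Mathlib.Tactic.NormNum
import Mathlib.Tactic.Ring
import HarnessLib

/-! # Norms of `A`, `B` for `y² = x³ + Ax² + Bx` of potentially good reduction at `3` — stub
# `stub_twoTorsionNorms` of line `Sketch`, crux `MazurKenkuBound` (stmt-ABC-15125)

WHAT. Over an ultrametric normed field `F` with `‖3‖ = 1/3` and `‖2‖ = 1` (a `3`-adic field), the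
model `y² = x³ + Ax² + Bx` with one rational `2`-torsion point at the origin has discriminant
`Δ = 16B²(A² − 4B)` and `c₄ = 16(A² − 3B)`.  If `Δ ≠ 0` and `‖c₄‖³ ≤ ‖Δ‖` (potentially good
reduction, `‖j‖ ≤ 1`), then `‖A‖⁶ ≤ ‖Δ‖` and `‖B‖³ = ‖Δ‖`.  The assembly stub of the line uses this
to see that the twist by `Δ^{1/12}` is an integral model with unit `B''` and unit discriminant.

PROOF. Pure ultrametric case analysis.  Put `X := ‖A‖² = ‖A²‖` and `Y := ‖B‖ > 0`; since
`‖16‖ = ‖4‖ = 1`, `‖Δ‖ = Y² ‖A² − 4B‖`, `‖c₄‖ = ‖A² − 3B‖`, `‖4B‖ = Y`, `‖3B‖ = Y/3`.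
* `X < Y`: `‖A² − 4B‖ = Y`, so `‖Δ‖ = Y³` and `‖A‖⁶ = X³ ≤ Y³`.
* `X = Y`: if `‖A² − 4B‖ = Y` the same computation concludes; otherwise `‖A² − 4B‖ < Y`, and then
  `A² − 3B = (A² − 4B) + B` has norm `Y`, so `Y³ = ‖c₄‖³ ≤ ‖Δ‖ = Y² ‖A² − 4B‖ < Y³`, absurd.
* `Y < X`: `‖A² − 4B‖ = ‖A² − 3B‖ = X` (as `‖4B‖ = Y < X` and `‖3B‖ = Y/3 < X`), so the hypothesis
  reads `X³ ≤ Y² X`, i.e. `X² ≤ Y²`, i.e. `X ≤ Y`, absurd.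
-/

-- `Summit.<Summit>.<Problem>` is the mandated summit-side namespace (CONVENTIONS §2); for the
-- single-conjunct summit `ABC` the two coincide, so the duplicate `ABC.ABC` is deliberate.
set_option linter.dupNamespace false

noncomputable section

namespace Summit.ABC.ABC.Theorems

/-- In an ultrametric normed ring, `‖x - y‖ = ‖x‖` as soon as `‖y‖ < ‖x‖`. [folklore] -/
private theorem norm_sub_eq_left_of_norm_lt {F : Type*} [NormedField F] [IsUltrametricDist F]
    {x y : F} (h : ‖y‖ < ‖x‖) : ‖x - y‖ = ‖x‖ := by
  rw [sub_eq_add_neg,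
    IsUltrametricDist.norm_add_eq_max_of_norm_ne_norm (by rw [norm_neg]; exact h.ne'), norm_neg,
    max_eq_left h.le]

/-- In an ultrametric normed ring, `‖x - y‖ = ‖y‖` as soon as `‖x‖ < ‖y‖`. [folklore] -/
private theorem norm_sub_eq_right_of_norm_lt {F : Type*} [NormedField F] [IsUltrametricDist F]
    {x y : F} (h : ‖x‖ < ‖y‖) : ‖x - y‖ = ‖y‖ := by
  rw [sub_eq_add_neg,
    IsUltrametricDist.norm_add_eq_max_of_norm_ne_norm (by rw [norm_neg]; exact h.ne), norm_neg,
    max_eq_right h.le]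

/-- **Norms of the coefficients of `y² = x³ + Ax² + Bx` with potentially good reduction at `3`.**
Over an ultrametric normed field with `‖3‖ = 1/3` and `‖2‖ = 1`: if
`Δ = 16B²(A² − 4B) ≠ 0` and `‖16(A² − 3B)‖³ ≤ ‖Δ‖` (that is `‖c₄‖³ ≤ ‖Δ‖`, `‖j‖ ≤ 1`), then
`‖A‖⁶ ≤ ‖Δ‖` and `‖B‖³ = ‖Δ‖` (ultrametric case analysis on `‖A‖²` versus `‖B‖`; the integrality
hypotheses `‖A‖, ‖B‖ ≤ 1` are not needed). [folklore] -/
theorem stub_twoTorsionNorms :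
    ∀ {F : Type*} [NormedField F] [IsUltrametricDist F], ‖(3 : F)‖ = 3⁻¹ → ‖(2 : F)‖ = 1 →
      ∀ (A B : F), ‖A‖ ≤ 1 → ‖B‖ ≤ 1 → 16 * B ^ 2 * (A ^ 2 - 4 * B) ≠ 0 →
      ‖16 * (A ^ 2 - 3 * B)‖ ^ 3 ≤ ‖16 * B ^ 2 * (A ^ 2 - 4 * B)‖ →
      ‖A‖ ^ 6 ≤ ‖16 * B ^ 2 * (A ^ 2 - 4 * B)‖ ∧ ‖B‖ ^ 3 = ‖16 * B ^ 2 * (A ^ 2 - 4 * B)‖ := by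
  intro F _ _ h3 h2 A B _ _ hΔ hj
  -- norms of the numerals `4 = 2²` and `16 = 2⁴`
  have h4 : ‖(4 : F)‖ = 1 := by
    rw [show (4 : F) = 2 ^ 2 by norm_num, norm_pow, h2, one_pow]
  have h16 : ‖(16 : F)‖ = 1 := by
    rw [show (16 : F) = 2 ^ 4 by norm_num, norm_pow, h2, one_pow]
  -- `B ≠ 0` from `Δ ≠ 0`
  have hB : B ≠ 0 := by
    rintro rfl
    exact hΔ (by ring)
  -- the two sizes `X = ‖A‖² = ‖A²‖` and `Y = ‖B‖ > 0`
  set X : ℝ := ‖A‖ ^ 2 with hX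
  set Y : ℝ := ‖B‖ with hY
  have hY0 : 0 < Y := norm_pos_iff.mpr hB
  have hX0 : 0 ≤ X := by positivity
  have hA2 : ‖A ^ 2‖ = X := norm_pow A 2
  have h4B : ‖4 * B‖ = Y := by rw [norm_mul, h4, one_mul]
  have h3B : ‖3 * B‖ = Y / 3 := by rw [norm_mul, h3, hY, inv_mul_eq_div]
  -- `‖Δ‖ = Y² ‖A² − 4B‖` and `‖c₄‖ = ‖A² − 3B‖`
  have hΔn : ‖16 * B ^ 2 * (A ^ 2 - 4 * B)‖ = Y ^ 2 * ‖A ^ 2 - 4 * B‖ := by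
    rw [norm_mul, norm_mul, h16, one_mul, norm_pow]
  have hc4n : ‖16 * (A ^ 2 - 3 * B)‖ = ‖A ^ 2 - 3 * B‖ := by rw [norm_mul, h16, one_mul]
  rw [hΔn, hc4n] at hj
  rw [hΔn]
  -- the good case `‖A² − 4B‖ = Y`, `X ≤ Y`
  have good : ‖A ^ 2 - 4 * B‖ = Y → X ≤ Y →
      ‖A‖ ^ 6 ≤ Y ^ 2 * ‖A ^ 2 - 4 * B‖ ∧ ‖B‖ ^ 3 = Y ^ 2 * ‖A ^ 2 - 4 * B‖ := by
    intro hD4 hXY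
    rw [hD4]
    refine ⟨?_, by rw [hY]; ring⟩
    calc ‖A‖ ^ 6 = X ^ 3 := by rw [hX]; ring
      _ ≤ Y ^ 3 := pow_le_pow_left₀ hX0 hXY 3
      _ = Y ^ 2 * Y := by ring
  rcases lt_trichotomy X Y with hlt | heq | hgt
  · -- `X < Y`: `‖A² − 4B‖ = ‖4B‖ = Y`
    exact good (by rw [norm_sub_eq_right_of_norm_lt (by rwa [hA2, h4B]), h4B]) hlt.le
  · -- `X = Y`: `‖A² − 4B‖ ≤ Y`, with equality the good case, otherwise a contradiction
    have hle : ‖A ^ 2 - 4 * B‖ ≤ Y :=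
      calc ‖A ^ 2 - 4 * B‖ = ‖A ^ 2 + -(4 * B)‖ := by rw [sub_eq_add_neg]
        _ ≤ max ‖A ^ 2‖ ‖-(4 * B)‖ := IsUltrametricDist.norm_add_le_max _ _
        _ = Y := by rw [norm_neg, hA2, h4B, heq, max_self]
    rcases hle.eq_or_lt with hD4 | hD4
    · exact good hD4 heq.le
    · exfalso
      -- `A² − 3B = (A² − 4B) + B` has norm `Y`
      have hD3 : ‖A ^ 2 - 3 * B‖ = Y := by
        rw [show A ^ 2 - 3 * B = A ^ 2 - 4 * B + B by ring,
          IsUltrametricDist.norm_add_eq_max_of_norm_ne_norm (by rw [← hY]; exact hD4.ne),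
          max_eq_right hD4.le]
      rw [hD3] at hj
      have hlt : Y ^ 2 * ‖A ^ 2 - 4 * B‖ < Y ^ 3 :=
        calc Y ^ 2 * ‖A ^ 2 - 4 * B‖ < Y ^ 2 * Y := mul_lt_mul_of_pos_left hD4 (by positivity)
          _ = Y ^ 3 := by ring
      exact absurd hj (not_le.mpr hlt)
  · -- `Y < X`: `‖A² − 4B‖ = ‖A² − 3B‖ = X`, and `X³ ≤ Y² X` forces `X ≤ Y`
    exfalso
    have hD4 : ‖A ^ 2 - 4 * B‖ = X := by
      rw [norm_sub_eq_left_of_norm_lt (by rwa [hA2, h4B]), hA2]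
    have h3Blt : ‖3 * B‖ < ‖A ^ 2‖ := by
      rw [h3B, hA2]
      linarith
    have hD3 : ‖A ^ 2 - 3 * B‖ = X := by rw [norm_sub_eq_left_of_norm_lt h3Blt, hA2]
    rw [hD4, hD3] at hj
    have hXpos : 0 < X := hY0.trans hgt
    have hsq : X ^ 2 ≤ Y ^ 2 := by
      have h' : X ^ 2 * X ≤ Y ^ 2 * X := by
        calc X ^ 2 * X = X ^ 3 := by ring
          _ ≤ Y ^ 2 * X := hj
      exact le_of_mul_le_mul_right h' hXpos
    have hXY : X ≤ Y := le_of_pow_le_pow_left₀ two_ne_zero hY0.le hsq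
    exact absurd hXY (not_le.mpr hgt)

end Summit.ABC.ABC.Theorems

end
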